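import Mathlib
import HarnessLib
import Summits.HubbardSuperconductivity.HubbardSuperconductivity.Theorems.KLProgrammeH10TwoPointLimitPerturbedCountAnti
import Summits.HubbardSuperconductivity.HubbardSuperconductivity.Theorems.KLProgrammeH10TwoPointLimitPerturbedCountDiag

/-!
# Route `KLProgramme` — crux K1 `H10TwoPointLimit` (stmt-HubbardSuperconductivity-19938):
# the grid counts ON THE PERTURBED CURVE, III — the diagonal level counts and the dyadic depth summation

Port step (4c) of HOME/prover-p4/PORT-NOTE.md §6: the lineage's `KLProgrammeCountPairsOffsetFold.lean` (second half) for the perturbed level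
function `h^E`: the stratified key bound of the diagonal function with the TRUE second derivative of `x ↦ h^E(x, x)` (`diag_key_perturbed` =
`diag_strat_perturbed` at the shifted level of the momentum sum), the level counts of the diagonal function (`count_levels_diagE`, lemma L4 with
`|H'| ≤ M_diag = 2(4+κ₁)S_E`, `|H''| ≤ A_diag = 16S_E² + 8A_E + 4κ₂S_E² + 2κ₁A_E`), and the sum of the anti-diagonal counts through the tree's
dyadic depth argument (`count_anti_totalE`). Constants expanded as in `…PerturbedCountCooper/Fold/Lipschitz.lean` (named in
`KLProgrammePerturbedCountConstantsDefs.lean`). Everything is PROVED; no definitions.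
References: BGM 2006 Lemma 3.1 / App. A2 [cite: BenfattoGiulianiMastropietro2006].
-/

noncomputable section

namespace Summit.HubbardSuperconductivity.HubbardSuperconductivity.Theorems.PerturbedFermiCurve

set_option linter.dupNamespace false -- summit = problem name (single-conjunct summit), D-0017

open Real Set
open Literature.MathematicalPhysics.QuantumLattice Literature.MathematicalPhysics.QuantumLattice.BandSectorCounting

section DiagCounts

variable {a b : ℝ} (B : BandBounds a b) {δ : (Fin 2 → ℝ) → ℝ} (hδs : ContDiff ℝ 2 δ)
  {κ₀ κ₁ κ₂ μ : ℝ} (hδ : ∀ k : Fin 2 → ℝ, |δ k| ≤ κ₀) (hlo : a ≤ μ - κ₀) (hhi : μ + κ₀ ≤ b)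
  (hκ : ∀ k : Fin 2 → ℝ, ‖fderiv ℝ δ k‖ ≤ κ₁) (hκ₁ : κ₁ < B.Dtmin) (hκ₂ : ∀ k : Fin 2 → ℝ, ‖fderiv ℝ (fderiv ℝ δ) k‖ ≤ κ₂)
  {u : ℝ → ℝ} (hu : ∀ θ, IsBandFermiRadius (μ - δ (u θ • dir θ)) θ (u θ))
include B hδs hδ hlo hhi hκ hκ₁ hκ₂ hu

/-- **The stratified key bound of the diagonal function with the TRUE second derivative of `x ↦ h^E(x, x)`**: if `|h^E(σ,σ)| ≤ η₀` and
`|2∂₃h^E(σ,σ)| ≤ η₁` then the diagonal second derivative (the closed form of `hasDerivAt_two_h3E_diag`) is `≥ 2h_min` (`diag_strat_perturbed` at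
the shifted level of the momentum sum). [cite: BenfattoGiulianiMastropietro2006, App. A2] -/
theorem diag_key_perturbed {P : ℝ × ℝ} {σ η₀ η₁ : ℝ} (hlo' : a ≤ μ - κ₀ - η₀) (hhi' : μ + κ₀ + η₀ ≤ b)
    (hH : |hfunE δ u μ P σ σ| ≤ η₀) (hH' : |2 * h3E δ u P σ σ| ≤ η₁)
    (hsmall :
      16 * (κ₁ * (π * Real.sqrt 2 + 2 * B.smax) / (B.Dtmin - κ₁)) * ((B.smax + κ₁ * (π * Real.sqrt 2 + 2 * B.smax) / (B.Dtmin - κ₁)) + B.smax) +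
        (16 * (B.smax + κ₁ * (π * Real.sqrt 2 + 2 * B.smax) / (B.Dtmin - κ₁)) ^ 2 + 8 * ((((4 + κ₂) * (B.smax + κ₁ * (π * Real.sqrt 2 + 2 * B.smax) / (B.Dtmin - κ₁)) ^ 2 + (8 + 2 * κ₁) * ((4 + κ₁) * (π * Real.sqrt 2) / (B.Dtmin - κ₁)) + (4 + κ₁) * (π * Real.sqrt 2)) / (B.Dtmin - κ₁)) + 2 * ((4 + κ₁) * (π * Real.sqrt 2) / (B.Dtmin - κ₁)) + π * Real.sqrt 2)) *
          (η₀ / B.Dtmin + 2 * κ₀ / B.Dtmin + B.smax * (B.Cg * (η₁ / 2 / 2 + κ₁ * (B.smax + κ₁ * (π * Real.sqrt 2 + 2 * B.smax) / (B.Dtmin - κ₁)) / 2 + 2 * (κ₁ * (π * Real.sqrt 2 + 2 * B.smax) / (B.Dtmin - κ₁)) + 2 * B.smax * (η₀ / B.Dtmin) + 2 * B.smax * (2 * κ₀ / B.Dtmin)))) +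
        6 * (κ₂ * (B.smax + κ₁ * (π * Real.sqrt 2 + 2 * B.smax) / (B.Dtmin - κ₁)) ^ 2) + 4 * (κ₁ * ((((4 + κ₂) * (B.smax + κ₁ * (π * Real.sqrt 2 + 2 * B.smax) / (B.Dtmin - κ₁)) ^ 2 + (8 + 2 * κ₁) * ((4 + κ₁) * (π * Real.sqrt 2) / (B.Dtmin - κ₁)) + (4 + κ₁) * (π * Real.sqrt 2)) / (B.Dtmin - κ₁)) + 2 * ((4 + κ₁) * (π * Real.sqrt 2) / (B.Dtmin - κ₁)) + π * Real.sqrt 2)) ≤ 2 * B.hmin) :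
    2 * B.hmin ≤ 8 * (Real.cos (SXE u P σ σ) * VXE u σ ^ 2 + Real.cos (SYE u P σ σ) * VYE u σ ^ 2) +
      4 * (Real.sin (SXE u P σ σ) * (deriv (deriv u) σ * Real.cos σ - 2 * deriv u σ * Real.sin σ - u σ * Real.cos σ) +
        Real.sin (SYE u P σ σ) * (deriv (deriv u) σ * Real.sin σ + 2 * deriv u σ * Real.cos σ - u σ * Real.sin σ)) +
      (4 * fderiv ℝ (fderiv ℝ δ) (momE u P σ σ) ![VXE u σ, VYE u σ] ![VXE u σ, VYE u σ] +
        2 * fderiv ℝ δ (momE u P σ σ) ![(deriv (deriv u) σ * Real.cos σ - 2 * deriv u σ * Real.sin σ - u σ * Real.cos σ),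
          (deriv (deriv u) σ * Real.sin σ + 2 * deriv u σ * Real.cos σ - u σ * Real.sin σ)]) := by
  set S := momE u P σ σ with hS
  set μ' := μ - δ S with hμ'def
  have hz := abs_le.1 (hδ S)
  have hη₀ : 0 ≤ η₀ := (abs_nonneg _).trans hH
  have hμ' : μ' ∈ Icc a b := ⟨by linarith [hz.2], by linarith [hz.1]⟩
  have hh' : |eps2 (SXE u P σ σ) (SYE u P σ σ) - μ'| ≤ η₀ := by
    have : eps2 (SXE u P σ σ) (SYE u P σ σ) - μ' = hfunE δ u μ P σ σ := by rw [hμ'def, hS, hfunE]; ring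
    rw [this]; exact hH
  have hgap : ∀ θ, |μ' - (μ - δ (u θ • dir θ))| ≤ 2 * κ₀ := by
    intro θ
    have h1 := abs_le.1 (hδ (u θ • dir θ))
    rw [hμ'def, abs_le]; constructor <;> linarith [hz.1, hz.2]
  have hH'' : |2 * (2 * Real.sin (SXE u P σ σ) * VXE u σ + 2 * Real.sin (SYE u P σ σ) * VYE u σ + fderiv ℝ δ S ![VXE u σ, VYE u σ])| ≤ η₁ := by
    rw [hS]; exact hH'
  exact diag_strat_perturbed B hδs hδ hlo hhi hκ hκ₁ hκ₂ hu hμ' (by linarith [hz.2]) (by linarith [hz.1]) hh' hgap hH'' hsmall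

/-- **Level counts of the diagonal function** `H(σ) = h^E(σ, σ)` on the `σ`-grid `w/2 + s w/2`, `s < 4N`:
`#{|H| ≤ η} ≤ α η/w + β √η/w + γ` for every `η > 0` (lemma L4 below `η₀/2`, trivial above), `M₁ = M_diag`, `A = A_diag`, `c₂ = 2h_min`.
[cite: BenfattoGiulianiMastropietro2006, Lemma 3.1] -/
theorem count_levels_diagE {P : ℝ × ℝ} {w η₀ η₁ η : ℝ} (hw : 0 < w) {N : ℕ} (hN : (N : ℝ) * w = 2 * π) (hη : 0 < η)
    (hη₀ : 0 < η₀) (hη₁ : 0 < η₁) (hlo' : a ≤ μ - κ₀ - η₀) (hhi' : μ + κ₀ + η₀ ≤ b)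
    (hsmallH :
      16 * (κ₁ * (π * Real.sqrt 2 + 2 * B.smax) / (B.Dtmin - κ₁)) * ((B.smax + κ₁ * (π * Real.sqrt 2 + 2 * B.smax) / (B.Dtmin - κ₁)) + B.smax) +
        (16 * (B.smax + κ₁ * (π * Real.sqrt 2 + 2 * B.smax) / (B.Dtmin - κ₁)) ^ 2 + 8 * ((((4 + κ₂) * (B.smax + κ₁ * (π * Real.sqrt 2 + 2 * B.smax) / (B.Dtmin - κ₁)) ^ 2 + (8 + 2 * κ₁) * ((4 + κ₁) * (π * Real.sqrt 2) / (B.Dtmin - κ₁)) + (4 + κ₁) * (π * Real.sqrt 2)) / (B.Dtmin - κ₁)) + 2 * ((4 + κ₁) * (π * Real.sqrt 2) / (B.Dtmin - κ₁)) + π * Real.sqrt 2)) *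
          (η₀ / B.Dtmin + 2 * κ₀ / B.Dtmin + B.smax * (B.Cg * (η₁ / 2 / 2 + κ₁ * (B.smax + κ₁ * (π * Real.sqrt 2 + 2 * B.smax) / (B.Dtmin - κ₁)) / 2 + 2 * (κ₁ * (π * Real.sqrt 2 + 2 * B.smax) / (B.Dtmin - κ₁)) + 2 * B.smax * (η₀ / B.Dtmin) + 2 * B.smax * (2 * κ₀ / B.Dtmin)))) +
        6 * (κ₂ * (B.smax + κ₁ * (π * Real.sqrt 2 + 2 * B.smax) / (B.Dtmin - κ₁)) ^ 2) + 4 * (κ₁ * ((((4 + κ₂) * (B.smax + κ₁ * (π * Real.sqrt 2 + 2 * B.smax) / (B.Dtmin - κ₁)) ^ 2 + (8 + 2 * κ₁) * ((4 + κ₁) * (π * Real.sqrt 2) / (B.Dtmin - κ₁)) + (4 + κ₁) * (π * Real.sqrt 2)) / (B.Dtmin - κ₁)) + 2 * ((4 + κ₁) * (π * Real.sqrt 2) / (B.Dtmin - κ₁)) + π * Real.sqrt 2)) ≤ 2 * B.hmin)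
    (hM : 0 < (2 * ((4 + κ₁) * (B.smax + κ₁ * (π * Real.sqrt 2 + 2 * B.smax) / (B.Dtmin - κ₁))))) (hA : 0 < (16 * (B.smax + κ₁ * (π * Real.sqrt 2 + 2 * B.smax) / (B.Dtmin - κ₁)) ^ 2 + 8 * ((((4 + κ₂) * (B.smax + κ₁ * (π * Real.sqrt 2 + 2 * B.smax) / (B.Dtmin - κ₁)) ^ 2 + (8 + 2 * κ₁) * ((4 + κ₁) * (π * Real.sqrt 2) / (B.Dtmin - κ₁)) + (4 + κ₁) * (π * Real.sqrt 2)) / (B.Dtmin - κ₁)) + 2 * ((4 + κ₁) * (π * Real.sqrt 2) / (B.Dtmin - κ₁)) + π * Real.sqrt 2) + 4 * (κ₂ * (B.smax + κ₁ * (π * Real.sqrt 2 + 2 * B.smax) / (B.Dtmin - κ₁)) ^ 2) + 2 * (κ₁ * ((((4 + κ₂) * (B.smax + κ₁ * (π * Real.sqrt 2 + 2 * B.smax) / (B.Dtmin - κ₁)) ^ 2 + (8 + 2 * κ₁) * ((4 + κ₁) * (π * Real.sqrt 2) / (B.Dtmin - κ₁)) + (4 + κ₁) * (π * Real.sqrt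 2)) / (B.Dtmin - κ₁)) + 2 * ((4 + κ₁) * (π * Real.sqrt 2) / (B.Dtmin - κ₁)) + π * Real.sqrt 2)))) :
    ((((Finset.range (4 * N)).filter fun s : ℕ => |hfunE δ u μ P (w / 2 + s * (w / 2)) (w / 2 + s * (w / 2))| ≤ η).card : ℝ)) ≤
      (32 * (4 * π / min (η₀ / (2 * (2 * ((4 + κ₁) * (B.smax + κ₁ * (π * Real.sqrt 2 + 2 * B.smax) / (B.Dtmin - κ₁)))))) (η₁ / (4 * (16 * (B.smax + κ₁ * (π * Real.sqrt 2 + 2 * B.smax) / (B.Dtmin - κ₁)) ^ 2 + 8 * ((((4 + κ₂) * (B.smax + κ₁ * (π * Real.sqrt 2 + 2 * B.smax) / (B.Dtmin - κ₁)) ^ 2 + (8 + 2 * κ₁) * ((4 + κ₁) * (π * Real.sqrt 2) / (B.Dtmin - κ₁)) + (4 + κ₁) * (π * Real.sqrt 2)) / (B.Dtmin - κ₁)) + 2 * ((4 + κ₁) * (π * Real.sqrt 2) / (B.Dtmin - κ₁)) + π * Real.sqrt 2) + 4 * (κ₂ * (B.smax + κ₁ * (π * Real.sqrt 2 + 2 *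 B.smax) / (B.Dtmin - κ₁)) ^ 2) + 2 * (κ₁ * ((((4 + κ₂) * (B.smax + κ₁ * (π * Real.sqrt 2 + 2 * B.smax) / (B.Dtmin - κ₁)) ^ 2 + (8 + 2 * κ₁) * ((4 + κ₁) * (π * Real.sqrt 2) / (B.Dtmin - κ₁)) + (4 + κ₁) * (π * Real.sqrt 2)) / (B.Dtmin - κ₁)) + 2 * ((4 + κ₁) * (π * Real.sqrt 2) / (B.Dtmin - κ₁)) + π * Real.sqrt 2))))) + 1) / η₁ + 16 * π / η₀) * η / w +
      (8 * (4 * π / min (η₀ / (2 * (2 * ((4 + κ₁) * (B.smax + κ₁ * (π * Real.sqrt 2 + 2 * B.smax) / (B.Dtmin - κ₁)))))) (η₁ / (4 * (16 * (B.smax + κ₁ * (π * Real.sqrt 2 + 2 * B.smax) / (B.Dtmin - κ₁)) ^ 2 + 8 * ((((4 + κ₂) * (B.smax + κ₁ * (π * Real.sqrt 2 + 2 * B.smax) / (B.Dtmin - κ₁)) ^ 2 + (8 + 2 * κ₁) * ((4 + κ₁) * (π * Real.sqrt 2) / (B.Dtmin - κ₁)) + (4 + κ₁) * (π * Real.sqrt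 2)) / (B.Dtmin - κ₁)) + 2 * ((4 + κ₁) * (π * Real.sqrt 2) / (B.Dtmin - κ₁)) + π * Real.sqrt 2) + 4 * (κ₂ * (B.smax + κ₁ * (π * Real.sqrt 2 + 2 * B.smax) / (B.Dtmin - κ₁)) ^ 2) + 2 * (κ₁ * ((((4 + κ₂) * (B.smax + κ₁ * (π * Real.sqrt 2 + 2 * B.smax) / (B.Dtmin - κ₁)) ^ 2 + (8 + 2 * κ₁) * ((4 + κ₁) * (π * Real.sqrt 2) / (B.Dtmin - κ₁)) + (4 + κ₁) * (π * Real.sqrt 2)) / (B.Dtmin - κ₁)) + 2 * ((4 + κ₁) * (π * Real.sqrt 2) / (B.Dtmin - κ₁)) + π * Real.sqrt 2))))) + 1) / Real.sqrt (2 * B.hmin)) * Real.sqrt η / w +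
      2 * (4 * π / min (η₀ / (2 * (2 * ((4 + κ₁) * (B.smax + κ₁ * (π * Real.sqrt 2 + 2 * B.smax) / (B.Dtmin - κ₁)))))) (η₁ / (4 * (16 * (B.smax + κ₁ * (π * Real.sqrt 2 + 2 * B.smax) / (B.Dtmin - κ₁)) ^ 2 + 8 * ((((4 + κ₂) * (B.smax + κ₁ * (π * Real.sqrt 2 + 2 * B.smax) / (B.Dtmin - κ₁)) ^ 2 + (8 + 2 * κ₁) * ((4 + κ₁) * (π * Real.sqrt 2) / (B.Dtmin - κ₁)) + (4 + κ₁) * (π * Real.sqrt 2)) / (B.Dtmin - κ₁)) + 2 * ((4 + κ₁) * (π * Real.sqrt 2) / (B.Dtmin - κ₁)) + π * Real.sqrt 2) + 4 * (κ₂ * (B.smax + κ₁ * (π * Real.sqrt 2 + 2 * B.smax) / (B.Dtmin - κ₁)) ^ 2) + 2 * (κ₁ * ((((4 + κ₂) * (B.smax + κ₁ * (π * Real.sqrt 2 + 2 * B.smax) / (B.Dtmin - κ₁)) ^ 2 + (8 + 2 * κ₁) * ((4 + κ₁) * (π * Real.sqrt 2) / (B.Dtmin - κ₁)) + (4 + κ₁)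 * (π * Real.sqrt 2)) / (B.Dtmin - κ₁)) + 2 * ((4 + κ₁) * (π * Real.sqrt 2) / (B.Dtmin - κ₁)) + π * Real.sqrt 2))))) + 1) := by
  have h2ne : (2 : WithTop ℕ∞) ≠ 0 := by norm_num
  have hh := B.hmin_pos
  set ℓ₄ := min (η₀ / (2 * (2 * ((4 + κ₁) * (B.smax + κ₁ * (π * Real.sqrt 2 + 2 * B.smax) / (B.Dtmin - κ₁)))))) (η₁ / (4 * (16 * (B.smax + κ₁ * (π * Real.sqrt 2 + 2 * B.smax) / (B.Dtmin - κ₁)) ^ 2 + 8 * ((((4 + κ₂) * (B.smax + κ₁ * (π * Real.sqrt 2 + 2 * B.smax) / (B.Dtmin - κ₁)) ^ 2 + (8 + 2 * κ₁) * ((4 + κ₁) * (π * Real.sqrt 2) / (B.Dtmin - κ₁)) + (4 + κ₁) * (π * Real.sqrt 2)) / (B.Dtmin - κ₁)) + 2 * ((4 + κ₁) * (π * Real.sqrt 2) / (B.Dtmin - κ₁)) + π * Real.sqrt 2) + 4 * (κ₂ * (B.smax + κ₁ * (π * Real.sqrt 2 + 2 * B.smax) / (B.Dtmin - κ₁)) ^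 2) + 2 * (κ₁ * ((((4 + κ₂) * (B.smax + κ₁ * (π * Real.sqrt 2 + 2 * B.smax) / (B.Dtmin - κ₁)) ^ 2 + (8 + 2 * κ₁) * ((4 + κ₁) * (π * Real.sqrt 2) / (B.Dtmin - κ₁)) + (4 + κ₁) * (π * Real.sqrt 2)) / (B.Dtmin - κ₁)) + 2 * ((4 + κ₁) * (π * Real.sqrt 2) / (B.Dtmin - κ₁)) + π * Real.sqrt 2))))) with hℓ₄
  have hℓ₄0 : 0 < ℓ₄ := lt_min (by positivity) (by positivity)
  set Q₄ := 4 * π / ℓ₄ + 1 with hQ₄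
  have hQ₄0 : 0 < Q₄ := by positivity
  have h4N : ((4 * N : ℕ) : ℝ) * (w / 2) = 4 * π := by push_cast; linear_combination 2 * hN
  have hsq : 0 < Real.sqrt (2 * B.hmin) := Real.sqrt_pos.2 (by positivity)
  rcases le_or_gt η (η₀ / 2) with hle | hgt
  · have h := gridCount_L4 (g := fun x => hfunE δ u μ P x x)
      (g' := fun x => 2 * h3E δ u P x x)
      (g'' := fun x => 8 * (Real.cos (SXE u P x x) * VXE u x ^ 2 + Real.cos (SYE u P x x) * VYE u x ^ 2) +
        4 * (Real.sin (SXE u P x x) * (deriv (deriv u) x * Real.cos x - 2 * deriv u x * Real.sin x - u x * Real.cos x) +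
          Real.sin (SYE u P x x) * (deriv (deriv u) x * Real.sin x + 2 * deriv u x * Real.cos x - u x * Real.sin x)) +
        (4 * fderiv ℝ (fderiv ℝ δ) (momE u P x x) ![VXE u x, VYE u x] ![VXE u x, VYE u x] +
          2 * fderiv ℝ δ (momE u P x x) ![(deriv (deriv u) x * Real.cos x - 2 * deriv u x * Real.sin x - u x * Real.cos x),
            (deriv (deriv u) x * Real.sin x + 2 * deriv u x * Real.cos x - u x * Real.sin x)]))
      (hasDerivAt_hfunE_diagZero B hδs hδ hlo hhi hκ hκ₁ hu P) (hasDerivAt_two_h3E_diag B hδs hδ hlo hhi hκ hκ₁ hu P)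
      (M₁ := (2 * ((4 + κ₁) * (B.smax + κ₁ * (π * Real.sqrt 2 + 2 * B.smax) / (B.Dtmin - κ₁))))) (A := (16 * (B.smax + κ₁ * (π * Real.sqrt 2 + 2 * B.smax) / (B.Dtmin - κ₁)) ^ 2 + 8 * ((((4 + κ₂) * (B.smax + κ₁ * (π * Real.sqrt 2 + 2 * B.smax) / (B.Dtmin - κ₁)) ^ 2 + (8 + 2 * κ₁) * ((4 + κ₁) * (π * Real.sqrt 2) / (B.Dtmin - κ₁)) + (4 + κ₁) * (π * Real.sqrt 2)) / (B.Dtmin - κ₁)) + 2 * ((4 + κ₁) * (π * Real.sqrt 2) / (B.Dtmin - κ₁)) + π * Real.sqrt 2) + 4 * (κ₂ * (B.smax + κ₁ * (π * Real.sqrt 2 + 2 * B.smax) / (B.Dtmin - κ₁)) ^ 2) + 2 * (κ₁ * ((((4 + κ₂) * (B.smax + κ₁ * (π * Real.sqrt 2 + 2 * B.smax) / (B.Dtmin - κ₁)) ^ 2 + (8 + 2 * κ₁) * ((4 + κ₁) * (π * Real.sqrt 2) / (B.Dtmin - κ₁)) + (4 + κ₁) * (π * Real.sqrt 2)) / (B.Dtmin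 - κ₁)) + 2 * ((4 + κ₁) * (π * Real.sqrt 2) / (B.Dtmin - κ₁)) + π * Real.sqrt 2)))) (η₀ := η₀) (η₁ := η₁) (c₂ := 2 * B.hmin) (δ := η)
      hM hA hη₀ hη₁ (by positivity) hη.le hle
      (fun z => by
        rw [abs_mul, abs_two]
        have := abs_h3E_le B hδs hδ hlo hhi hκ hκ₁ hu P z z
        linarith)
      (abs_diag_deriv2E_le B hδs hδ hlo hhi hκ hκ₁ hκ₂ hu P)
      (fun z hz hz' => diag_key_perturbed B hδs hδ hlo hhi hκ hκ₁ hκ₂ hu hlo' hhi' hz hz' hsmallH) (x₀ := w / 2) (w := w / 2) (half_pos hw) (4 * N)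
    clear hsmallH hM hA
    rw [h4N] at h
    refine h.trans ?_
    have hmax : max (8 * η / η₁) (2 * Real.sqrt (η / (2 * B.hmin))) ≤ 8 * η / η₁ + 2 * (Real.sqrt η / Real.sqrt (2 * B.hmin)) := by
      rw [Real.sqrt_div hη.le]
      exact max_le (by linarith [div_nonneg (Real.sqrt_nonneg η) hsq.le]) (by linarith [div_nonneg (by linarith : 0 ≤ 8 * η) hη₁.le])
    have hQ : 4 * π / ℓ₄ + 1 = Q₄ := rfl
    rw [hQ]
    have e : Q₄ * (2 * ((8 * η / η₁ + 2 * (Real.sqrt η / Real.sqrt (2 * B.hmin))) / (w / 2) + 1)) =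
        32 * Q₄ / η₁ * η / w + 8 * Q₄ / Real.sqrt (2 * B.hmin) * Real.sqrt η / w + 2 * Q₄ := by
      field_simp; ring
    calc Q₄ * (2 * (max (8 * η / η₁) (2 * Real.sqrt (η / (2 * B.hmin))) / (w / 2) + 1))
        ≤ Q₄ * (2 * ((8 * η / η₁ + 2 * (Real.sqrt η / Real.sqrt (2 * B.hmin))) / (w / 2) + 1)) := by
          gcongr
      _ = 32 * Q₄ / η₁ * η / w + 8 * Q₄ / Real.sqrt (2 * B.hmin) * Real.sqrt η / w + 2 * Q₄ := e
      _ ≤ _ := by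
          have t1 : 0 ≤ 16 * π / η₀ * η / w := by positivity
          have t2 : (32 * Q₄ / η₁ + 16 * π / η₀) * η / w = 32 * Q₄ / η₁ * η / w + 16 * π / η₀ * η / w := by ring
          rw [t2]; linarith only [t1]
  · have hcard : ((((Finset.range (4 * N)).filter fun s : ℕ =>
        |hfunE δ u μ P (w / 2 + s * (w / 2)) (w / 2 + s * (w / 2))| ≤ η).card : ℝ)) ≤ 8 * π / w := by
      calc _ ≤ (((Finset.range (4 * N)).card : ℝ)) := by exact_mod_cast Finset.card_filter_le _ _
        _ = 4 * N := by rw [Finset.card_range]; push_cast; ring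
        _ = 8 * π / w := by field_simp; linear_combination 4 * hN
    clear hsmallH hM hA
    have hb : 8 * π / w ≤ 16 * π / η₀ * η / w := by
      rw [div_le_div_iff_of_pos_right hw]
      rw [div_mul_eq_mul_div, le_div_iff₀ hη₀]
      have := mul_lt_mul_of_pos_left hgt (by positivity : (0:ℝ) < 16 * π)
      linarith only [this]
    have t1 : 0 ≤ 32 * Q₄ / η₁ * η / w := by positivity
    have t2 : 0 ≤ 8 * Q₄ / Real.sqrt (2 * B.hmin) * Real.sqrt η / w := by positivity
    have t3 : (32 * Q₄ / η₁ + 16 * π / η₀) * η / w = 32 * Q₄ / η₁ * η / w + 16 * π / η₀ * η / w := by ring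
    rw [t3]
    linarith only [hcard, hb, t1, t2, hQ₄0]

/-- **Sum of the anti-diagonal counts** over the `σ`-grid, through the dyadic depth argument:
`Σ_{s<4N} E(s) ≤ (τ/ℓ₅ + 1)·2·((J+1) K_dy / w + 4N)`, `ℓ₅ = min(η₀/(2M_anti τ), 2λ/M_Γ)`, `c = h_min/2`, `M = M_anti`.
[cite: BenfattoGiulianiMastropietro2006, Lemma 3.1 / (2.80)] -/
theorem count_anti_totalE {P : ℝ × ℝ} {w Cδ lam τ η₀ η₁ : ℝ} (hw : 0 < w) (hw1 : w ≤ 1) {N J : ℕ} (hN : (N : ℝ) * w = 2 * π)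
    (hJ : (2 : ℝ) ^ J * w = π) (hCδ : 0 < Cδ) (hlam : 0 < lam) (hτ : 0 < τ) (hη₀ : 0 < η₀) (hη₁ : 0 < η₁)
    (h2δ : Cδ * w ≤ η₀ / 2) (hlo' : a ≤ μ - κ₀ - η₀) (hhi' : μ + κ₀ + η₀ ≤ b)
    (heven :
      4 * (κ₁ * (π * Real.sqrt 2 + 2 * B.smax) / (B.Dtmin - κ₁)) * ((B.smax + κ₁ * (π * Real.sqrt 2 + 2 * B.smax) / (B.Dtmin - κ₁)) + B.smax) +
          (κ₂ * (B.smax + κ₁ * (π * Real.sqrt 2 + 2 * B.smax) / (B.Dtmin - κ₁)) ^ 2 + κ₁ * ((((4 + κ₂) * (B.smax + κ₁ * (π * Real.sqrt 2 + 2 * B.smax) / (B.Dtmin - κ₁)) ^ 2 + (8 + 2 * κ₁) * ((4 + κ₁) * (π * Real.sqrt 2) / (B.Dtmin - κ₁)) + (4 + κ₁) * (π * Real.sqrt 2)) / (B.Dtmin - κ₁)) + 2 * ((4 + κ₁) * (π * Real.sqrt 2) / (B.Dtmin - κ₁)) + π * Real.sqrt 2)) / 2 +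
        2 * ((((4 + κ₂) * (B.smax + κ₁ * (π * Real.sqrt 2 + 2 * B.smax) / (B.Dtmin - κ₁)) ^ 2 + (8 + 2 * κ₁) * ((4 + κ₁) * (π * Real.sqrt 2) / (B.Dtmin - κ₁)) + (4 + κ₁) * (π * Real.sqrt 2)) / (B.Dtmin - κ₁)) + 2 * ((4 + κ₁) * (π * Real.sqrt 2) / (B.Dtmin - κ₁)) + π * Real.sqrt 2) *
          (η₀ / B.Dtmin + 2 * κ₀ / B.Dtmin + B.smax * (B.Cg * ((2 * lam + (4 + κ₁) * ((((4 + κ₂) * (B.smax + κ₁ * (π * Real.sqrt 2 + 2 * B.smax) / (B.Dtmin - κ₁)) ^ 2 + (8 + 2 * κ₁) * ((4 + κ₁) * (π * Real.sqrt 2) / (B.Dtmin - κ₁)) + (4 + κ₁) * (π * Real.sqrt 2)) / (B.Dtmin - κ₁)) + 2 * ((4 + κ₁) * (π * Real.sqrt 2) / (B.Dtmin - κ₁)) + π * Real.sqrt 2) * τ / 2) / 2 + κ₁ * (B.smax + κ₁ * (π * Real.sqrt 2 + 2 * B.smax) / (B.Dtmin - κ₁)) / 2 + 2 * (κ₁ *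 (π * Real.sqrt 2 + 2 * B.smax) / (B.Dtmin - κ₁)) + 2 * B.smax * (η₀ / B.Dtmin) + 2 * B.smax * (2 * κ₀ / B.Dtmin)) + τ / 2)) +
        κ₁ * ((((4 + κ₂) * (B.smax + κ₁ * (π * Real.sqrt 2 + 2 * B.smax) / (B.Dtmin - κ₁)) ^ 2 + (8 + 2 * κ₁) * ((4 + κ₁) * (π * Real.sqrt 2) / (B.Dtmin - κ₁)) + (4 + κ₁) * (π * Real.sqrt 2)) / (B.Dtmin - κ₁)) + 2 * ((4 + κ₁) * (π * Real.sqrt 2) / (B.Dtmin - κ₁)) + π * Real.sqrt 2) / 2 ≤ B.hmin / 2)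
    (hH :
      16 * (κ₁ * (π * Real.sqrt 2 + 2 * B.smax) / (B.Dtmin - κ₁)) * ((B.smax + κ₁ * (π * Real.sqrt 2 + 2 * B.smax) / (B.Dtmin - κ₁)) + B.smax) +
        (16 * (B.smax + κ₁ * (π * Real.sqrt 2 + 2 * B.smax) / (B.Dtmin - κ₁)) ^ 2 + 8 * ((((4 + κ₂) * (B.smax + κ₁ * (π * Real.sqrt 2 + 2 * B.smax) / (B.Dtmin - κ₁)) ^ 2 + (8 + 2 * κ₁) * ((4 + κ₁) * (π * Real.sqrt 2) / (B.Dtmin - κ₁)) + (4 + κ₁) * (π * Real.sqrt 2)) / (B.Dtmin - κ₁)) + 2 * ((4 + κ₁) * (π * Real.sqrt 2) / (B.Dtmin - κ₁)) + π * Real.sqrt 2)) *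
          (η₀ / B.Dtmin + 2 * κ₀ / B.Dtmin + B.smax * (B.Cg * (η₁ / 2 / 2 + κ₁ * (B.smax + κ₁ * (π * Real.sqrt 2 + 2 * B.smax) / (B.Dtmin - κ₁)) / 2 + 2 * (κ₁ * (π * Real.sqrt 2 + 2 * B.smax) / (B.Dtmin - κ₁)) + 2 * B.smax * (η₀ / B.Dtmin) + 2 * B.smax * (2 * κ₀ / B.Dtmin)))) +
        6 * (κ₂ * (B.smax + κ₁ * (π * Real.sqrt 2 + 2 * B.smax) / (B.Dtmin - κ₁)) ^ 2) + 4 * (κ₁ * ((((4 + κ₂) * (B.smax + κ₁ * (π * Real.sqrt 2 + 2 * B.smax) / (B.Dtmin - κ₁)) ^ 2 + (8 + 2 * κ₁) * ((4 + κ₁) * (π * Real.sqrt 2) / (B.Dtmin - κ₁)) + (4 + κ₁) * (π * Real.sqrt 2)) / (B.Dtmin - κ₁)) + 2 * ((4 + κ₁) * (π * Real.sqrt 2) / (B.Dtmin - κ₁)) + π * Real.sqrt 2)) ≤ 2 * B.hmin)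
    (hMa : 0 < (2 * ((((4 + κ₂) * (B.smax + κ₁ * (π * Real.sqrt 2 + 2 * B.smax) / (B.Dtmin - κ₁)) ^ 2 + (8 + 2 * κ₁) * ((4 + κ₁) * (π * Real.sqrt 2) / (B.Dtmin - κ₁)) + (4 + κ₁) * (π * Real.sqrt 2)) / (B.Dtmin - κ₁)) + 2 * ((4 + κ₁) * (π * Real.sqrt 2) / (B.Dtmin - κ₁)) + π * Real.sqrt 2) + κ₁ * ((((4 + κ₂) * (B.smax + κ₁ * (π * Real.sqrt 2 + 2 * B.smax) / (B.Dtmin - κ₁)) ^ 2 + (8 + 2 * κ₁) * ((4 + κ₁) * (π * Real.sqrt 2) / (B.Dtmin - κ₁)) + (4 + κ₁) * (π * Real.sqrt 2)) / (B.Dtmin - κ₁)) + 2 * ((4 + κ₁) * (π * Real.sqrt 2) / (B.Dtmin - κ₁)) + π * Real.sqrt 2) / 2)) (hMG : 0 < (8 * (B.smax + κ₁ * (π * Real.sqrt 2 + 2 * B.smax) / (B.Dtmin - κ₁)) ^ 2 + 2 * (κ₂ * (B.smax + κ₁ * (π * Real.sqrt 2 + 2 * B.smax) / (B.Dtmin -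 κ₁)) ^ 2) + 4 * ((((4 + κ₂) * (B.smax + κ₁ * (π * Real.sqrt 2 + 2 * B.smax) / (B.Dtmin - κ₁)) ^ 2 + (8 + 2 * κ₁) * ((4 + κ₁) * (π * Real.sqrt 2) / (B.Dtmin - κ₁)) + (4 + κ₁) * (π * Real.sqrt 2)) / (B.Dtmin - κ₁)) + 2 * ((4 + κ₁) * (π * Real.sqrt 2) / (B.Dtmin - κ₁)) + π * Real.sqrt 2) + κ₁ * ((((4 + κ₂) * (B.smax + κ₁ * (π * Real.sqrt 2 + 2 * B.smax) / (B.Dtmin - κ₁)) ^ 2 + (8 + 2 * κ₁) * ((4 + κ₁) * (π * Real.sqrt 2) / (B.Dtmin - κ₁)) + (4 + κ₁) * (π * Real.sqrt 2)) / (B.Dtmin - κ₁)) + 2 * ((4 + κ₁) * (π * Real.sqrt 2) / (B.Dtmin - κ₁)) + π * Real.sqrt 2))) (hM : 0 < (2 * ((4 + κ₁) * (B.smax + κ₁ * (π * Real.sqrt 2 + 2 * B.smax) / (B.Dtmin - κ₁))))) (hA : 0 < (16 * (B.smax + κ₁ * (π * Real.sqrt 2 + 2 * B.smax) / (B.Dtmin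 - κ₁)) ^ 2 + 8 * ((((4 + κ₂) * (B.smax + κ₁ * (π * Real.sqrt 2 + 2 * B.smax) / (B.Dtmin - κ₁)) ^ 2 + (8 + 2 * κ₁) * ((4 + κ₁) * (π * Real.sqrt 2) / (B.Dtmin - κ₁)) + (4 + κ₁) * (π * Real.sqrt 2)) / (B.Dtmin - κ₁)) + 2 * ((4 + κ₁) * (π * Real.sqrt 2) / (B.Dtmin - κ₁)) + π * Real.sqrt 2) + 4 * (κ₂ * (B.smax + κ₁ * (π * Real.sqrt 2 + 2 * B.smax) / (B.Dtmin - κ₁)) ^ 2) + 2 * (κ₁ * ((((4 + κ₂) * (B.smax + κ₁ * (π * Real.sqrt 2 + 2 * B.smax) / (B.Dtmin - κ₁)) ^ 2 + (8 + 2 * κ₁) * ((4 + κ₁) * (π * Real.sqrt 2) / (B.Dtmin - κ₁)) + (4 + κ₁) * (π * Real.sqrt 2)) / (B.Dtmin - κ₁)) + 2 * ((4 + κ₁) * (π * Real.sqrt 2) / (B.Dtmin - κ₁)) + π * Real.sqrt 2)))) :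
    ∑ s ∈ Finset.range (4 * N), ((((Finset.range ⌊τ / w⌋₊).filter fun i : ℕ =>
        |hfunE δ u μ P (w / 2 + s * (w / 2) - (w + i * w) / 2) (w / 2 + s * (w / 2) + (w + i * w) / 2)| ≤ Cδ * w ∧
        |h3E δ u P (w / 2 + s * (w / 2) + (w + i * w) / 2) (w / 2 + s * (w / 2) - (w + i * w) / 2) +
          h3E δ u P (w / 2 + s * (w / 2) - (w + i * w) / 2) (w / 2 + s * (w / 2) + (w + i * w) / 2)| ≤ 2 * lam).card : ℝ)) ≤
      (τ / min (η₀ / (2 * (2 * ((((4 + κ₂) * (B.smax + κ₁ * (π * Real.sqrt 2 + 2 * B.smax) / (B.Dtmin - κ₁)) ^ 2 + (8 + 2 * κ₁) * ((4 + κ₁) * (π * Real.sqrt 2) / (B.Dtmin - κ₁)) + (4 + κ₁) * (π * Real.sqrt 2)) / (B.Dtmin - κ₁)) + 2 * ((4 + κ₁) * (π * Real.sqrt 2) / (B.Dtmin - κ₁)) + π * Real.sqrt 2) + κ₁ * ((((4 + κ₂) * (B.smax + κ₁ * (π * Real.sqrt 2 + 2 * B.smax) / (B.Dtmin - κ₁))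 ^ 2 + (8 + 2 * κ₁) * ((4 + κ₁) * (π * Real.sqrt 2) / (B.Dtmin - κ₁)) + (4 + κ₁) * (π * Real.sqrt 2)) / (B.Dtmin - κ₁)) + 2 * ((4 + κ₁) * (π * Real.sqrt 2) / (B.Dtmin - κ₁)) + π * Real.sqrt 2) / 2) * τ)) (2 * lam / (8 * (B.smax + κ₁ * (π * Real.sqrt 2 + 2 * B.smax) / (B.Dtmin - κ₁)) ^ 2 + 2 * (κ₂ * (B.smax + κ₁ * (π * Real.sqrt 2 + 2 * B.smax) / (B.Dtmin - κ₁)) ^ 2) + 4 * ((((4 + κ₂) * (B.smax + κ₁ * (π * Real.sqrt 2 + 2 * B.smax) / (B.Dtmin - κ₁)) ^ 2 + (8 + 2 * κ₁) * ((4 + κ₁) * (π * Real.sqrt 2) / (B.Dtmin - κ₁)) + (4 + κ₁) * (π * Real.sqrt 2)) / (B.Dtmin - κ₁)) + 2 * ((4 + κ₁) * (π * Real.sqrt 2) / (B.Dtmin - κ₁)) + π * Real.sqrt 2) + κ₁ * ((((4 + κ₂) * (B.smax + κ₁ * (π * Real.sqrt 2 + 2 * B.smax) / (B.Dtmin - κ₁))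 ^ 2 + (8 + 2 * κ₁) * ((4 + κ₁) * (π * Real.sqrt 2) / (B.Dtmin - κ₁)) + (4 + κ₁) * (π * Real.sqrt 2)) / (B.Dtmin - κ₁)) + 2 * ((4 + κ₁) * (π * Real.sqrt 2) / (B.Dtmin - κ₁)) + π * Real.sqrt 2))) + 1) * (2 *
        (((J : ℝ) + 1) * (2 * Real.sqrt (Cδ / (B.hmin / 2)) *
            (2 * (32 * (4 * π / min (η₀ / (2 * (2 * ((4 + κ₁) * (B.smax + κ₁ * (π * Real.sqrt 2 + 2 * B.smax) / (B.Dtmin - κ₁)))))) (η₁ / (4 * (16 * (B.smax + κ₁ * (π * Real.sqrt 2 + 2 * B.smax) / (B.Dtmin - κ₁)) ^ 2 + 8 * ((((4 + κ₂) * (B.smax + κ₁ * (π * Real.sqrt 2 + 2 * B.smax) / (B.Dtmin - κ₁)) ^ 2 + (8 + 2 * κ₁) * ((4 + κ₁) * (π * Real.sqrt 2) / (B.Dtmin - κ₁)) + (4 + κ₁) * (π * Real.sqrt 2)) / (B.Dtmin - κ₁)) + 2 * ((4 + κ₁) * (π * Real.sqrt 2) / (B.Dtmin - κ₁)) + π *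 Real.sqrt 2) + 4 * (κ₂ * (B.smax + κ₁ * (π * Real.sqrt 2 + 2 * B.smax) / (B.Dtmin - κ₁)) ^ 2) + 2 * (κ₁ * ((((4 + κ₂) * (B.smax + κ₁ * (π * Real.sqrt 2 + 2 * B.smax) / (B.Dtmin - κ₁)) ^ 2 + (8 + 2 * κ₁) * ((4 + κ₁) * (π * Real.sqrt 2) / (B.Dtmin - κ₁)) + (4 + κ₁) * (π * Real.sqrt 2)) / (B.Dtmin - κ₁)) + 2 * ((4 + κ₁) * (π * Real.sqrt 2) / (B.Dtmin - κ₁)) + π * Real.sqrt 2))))) + 1) / η₁ + 16 * π / η₀) * Cδ +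
              (8 * (4 * π / min (η₀ / (2 * (2 * ((4 + κ₁) * (B.smax + κ₁ * (π * Real.sqrt 2 + 2 * B.smax) / (B.Dtmin - κ₁)))))) (η₁ / (4 * (16 * (B.smax + κ₁ * (π * Real.sqrt 2 + 2 * B.smax) / (B.Dtmin - κ₁)) ^ 2 + 8 * ((((4 + κ₂) * (B.smax + κ₁ * (π * Real.sqrt 2 + 2 * B.smax) / (B.Dtmin - κ₁)) ^ 2 + (8 + 2 * κ₁) * ((4 + κ₁) * (π * Real.sqrt 2) / (B.Dtmin - κ₁)) + (4 + κ₁) * (π * Real.sqrt 2)) / (B.Dtmin - κ₁)) + 2 * ((4 + κ₁) * (π * Real.sqrt 2) / (B.Dtmin - κ₁)) + π * Real.sqrt 2) + 4 * (κ₂ * (B.smax + κ₁ * (π * Real.sqrt 2 + 2 * B.smax) / (B.Dtmin - κ₁)) ^ 2) + 2 * (κ₁ * ((((4 + κ₂) * (B.smax + κ₁ * (π * Real.sqrt 2 + 2 * B.smax) / (B.Dtmin - κ₁)) ^ 2 + (8 + 2 * κ₁) * ((4 + κ₁) * (π * Real.sqrt 2) / (B.Dtmin - κ₁)) + (4 +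 κ₁) * (π * Real.sqrt 2)) / (B.Dtmin - κ₁)) + 2 * ((4 + κ₁) * (π * Real.sqrt 2) / (B.Dtmin - κ₁)) + π * Real.sqrt 2))))) + 1) / Real.sqrt (2 * B.hmin)) * Real.sqrt (2 * Cδ) +
              2 * (4 * π / min (η₀ / (2 * (2 * ((4 + κ₁) * (B.smax + κ₁ * (π * Real.sqrt 2 + 2 * B.smax) / (B.Dtmin - κ₁)))))) (η₁ / (4 * (16 * (B.smax + κ₁ * (π * Real.sqrt 2 + 2 * B.smax) / (B.Dtmin - κ₁)) ^ 2 + 8 * ((((4 + κ₂) * (B.smax + κ₁ * (π * Real.sqrt 2 + 2 * B.smax) / (B.Dtmin - κ₁)) ^ 2 + (8 + 2 * κ₁) * ((4 + κ₁) * (π * Real.sqrt 2) / (B.Dtmin - κ₁)) + (4 + κ₁) * (π * Real.sqrt 2)) / (B.Dtmin - κ₁)) + 2 * ((4 + κ₁) * (π * Real.sqrt 2) / (B.Dtmin - κ₁)) + π * Real.sqrt 2) + 4 * (κ₂ * (B.smax + κ₁ * (π * Real.sqrt 2 + 2 * B.smax) / (B.Dtmin - κ₁)) ^ 2) + 2 *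 (κ₁ * ((((4 + κ₂) * (B.smax + κ₁ * (π * Real.sqrt 2 + 2 * B.smax) / (B.Dtmin - κ₁)) ^ 2 + (8 + 2 * κ₁) * ((4 + κ₁) * (π * Real.sqrt 2) / (B.Dtmin - κ₁)) + (4 + κ₁) * (π * Real.sqrt 2)) / (B.Dtmin - κ₁)) + 2 * ((4 + κ₁) * (π * Real.sqrt 2) / (B.Dtmin - κ₁)) + π * Real.sqrt 2))))) + 1)) +
          (2 * (32 * (4 * π / min (η₀ / (2 * (2 * ((4 + κ₁) * (B.smax + κ₁ * (π * Real.sqrt 2 + 2 * B.smax) / (B.Dtmin - κ₁)))))) (η₁ / (4 * (16 * (B.smax + κ₁ * (π * Real.sqrt 2 + 2 * B.smax) / (B.Dtmin - κ₁)) ^ 2 + 8 * ((((4 + κ₂) * (B.smax + κ₁ * (π * Real.sqrt 2 + 2 * B.smax) / (B.Dtmin - κ₁)) ^ 2 + (8 + 2 * κ₁) * ((4 + κ₁) * (π * Real.sqrt 2) / (B.Dtmin - κ₁)) + (4 + κ₁) * (π * Real.sqrt 2)) / (B.Dtmin - κ₁)) + 2 * ((4 + κ₁) * (π * Real.sqrt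 2) / (B.Dtmin - κ₁)) + π * Real.sqrt 2) + 4 * (κ₂ * (B.smax + κ₁ * (π * Real.sqrt 2 + 2 * B.smax) / (B.Dtmin - κ₁)) ^ 2) + 2 * (κ₁ * ((((4 + κ₂) * (B.smax + κ₁ * (π * Real.sqrt 2 + 2 * B.smax) / (B.Dtmin - κ₁)) ^ 2 + (8 + 2 * κ₁) * ((4 + κ₁) * (π * Real.sqrt 2) / (B.Dtmin - κ₁)) + (4 + κ₁) * (π * Real.sqrt 2)) / (B.Dtmin - κ₁)) + 2 * ((4 + κ₁) * (π * Real.sqrt 2) / (B.Dtmin - κ₁)) + π * Real.sqrt 2))))) + 1) / η₁ + 16 * π / η₀) *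
              (2 * Cδ * Real.sqrt (2 * (2 * ((((4 + κ₂) * (B.smax + κ₁ * (π * Real.sqrt 2 + 2 * B.smax) / (B.Dtmin - κ₁)) ^ 2 + (8 + 2 * κ₁) * ((4 + κ₁) * (π * Real.sqrt 2) / (B.Dtmin - κ₁)) + (4 + κ₁) * (π * Real.sqrt 2)) / (B.Dtmin - κ₁)) + 2 * ((4 + κ₁) * (π * Real.sqrt 2) / (B.Dtmin - κ₁)) + π * Real.sqrt 2) + κ₁ * ((((4 + κ₂) * (B.smax + κ₁ * (π * Real.sqrt 2 + 2 * B.smax) / (B.Dtmin - κ₁)) ^ 2 + (8 + 2 * κ₁) * ((4 + κ₁) * (π * Real.sqrt 2) / (B.Dtmin - κ₁)) + (4 + κ₁) * (π * Real.sqrt 2)) / (B.Dtmin - κ₁)) + 2 * ((4 + κ₁) * (π * Real.sqrt 2) / (B.Dtmin - κ₁)) + π * Real.sqrt 2) / 2)) / (B.hmin / 2)) * Real.sqrt (Cδ * π) +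
            Real.sqrt 2 * (8 * (4 * π / min (η₀ / (2 * (2 * ((4 + κ₁) * (B.smax + κ₁ * (π * Real.sqrt 2 + 2 * B.smax) / (B.Dtmin - κ₁)))))) (η₁ / (4 * (16 * (B.smax + κ₁ * (π * Real.sqrt 2 + 2 * B.smax) / (B.Dtmin - κ₁)) ^ 2 + 8 * ((((4 + κ₂) * (B.smax + κ₁ * (π * Real.sqrt 2 + 2 * B.smax) / (B.Dtmin - κ₁)) ^ 2 + (8 + 2 * κ₁) * ((4 + κ₁) * (π * Real.sqrt 2) / (B.Dtmin - κ₁)) + (4 + κ₁) * (π * Real.sqrt 2)) / (B.Dtmin - κ₁)) + 2 * ((4 + κ₁) * (π * Real.sqrt 2) / (B.Dtmin - κ₁)) + π * Real.sqrt 2) + 4 * (κ₂ * (B.smax + κ₁ * (π * Real.sqrt 2 + 2 * B.smax) / (B.Dtmin - κ₁)) ^ 2) + 2 * (κ₁ * ((((4 + κ₂) * (B.smax + κ₁ * (π * Real.sqrt 2 + 2 * B.smax) / (B.Dtmin - κ₁)) ^ 2 + (8 + 2 * κ₁) * ((4 + κ₁) * (π * Real.sqrt 2) / (B.Dtmin -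 κ₁)) + (4 + κ₁) * (π * Real.sqrt 2)) / (B.Dtmin - κ₁)) + 2 * ((4 + κ₁) * (π * Real.sqrt 2) / (B.Dtmin - κ₁)) + π * Real.sqrt 2))))) + 1) / Real.sqrt (2 * B.hmin)) *
              (2 * Cδ * Real.sqrt (2 * (2 * ((((4 + κ₂) * (B.smax + κ₁ * (π * Real.sqrt 2 + 2 * B.smax) / (B.Dtmin - κ₁)) ^ 2 + (8 + 2 * κ₁) * ((4 + κ₁) * (π * Real.sqrt 2) / (B.Dtmin - κ₁)) + (4 + κ₁) * (π * Real.sqrt 2)) / (B.Dtmin - κ₁)) + 2 * ((4 + κ₁) * (π * Real.sqrt 2) / (B.Dtmin - κ₁)) + π * Real.sqrt 2) + κ₁ * ((((4 + κ₂) * (B.smax + κ₁ * (π * Real.sqrt 2 + 2 * B.smax) / (B.Dtmin - κ₁)) ^ 2 + (8 + 2 * κ₁) * ((4 + κ₁) * (π * Real.sqrt 2) / (B.Dtmin - κ₁)) + (4 + κ₁) * (π * Real.sqrt 2)) / (B.Dtmin - κ₁)) + 2 * ((4 + κ₁) * (π * Real.sqrt 2) / (B.Dtmin - κ₁)) + π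 * Real.sqrt 2) / 2)) / (B.hmin / 2)) +
            2 * (4 * π / min (η₀ / (2 * (2 * ((4 + κ₁) * (B.smax + κ₁ * (π * Real.sqrt 2 + 2 * B.smax) / (B.Dtmin - κ₁)))))) (η₁ / (4 * (16 * (B.smax + κ₁ * (π * Real.sqrt 2 + 2 * B.smax) / (B.Dtmin - κ₁)) ^ 2 + 8 * ((((4 + κ₂) * (B.smax + κ₁ * (π * Real.sqrt 2 + 2 * B.smax) / (B.Dtmin - κ₁)) ^ 2 + (8 + 2 * κ₁) * ((4 + κ₁) * (π * Real.sqrt 2) / (B.Dtmin - κ₁)) + (4 + κ₁) * (π * Real.sqrt 2)) / (B.Dtmin - κ₁)) + 2 * ((4 + κ₁) * (π * Real.sqrt 2) / (B.Dtmin - κ₁)) + π * Real.sqrt 2) + 4 * (κ₂ * (B.smax + κ₁ * (π * Real.sqrt 2 + 2 * B.smax) / (B.Dtmin - κ₁)) ^ 2) + 2 * (κ₁ * ((((4 + κ₂) * (B.smax + κ₁ * (π * Real.sqrt 2 + 2 * B.smax) / (B.Dtmin - κ₁)) ^ 2 + (8 + 2 * κ₁) * ((4 + κ₁) * (π * Real.sqrt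 2) / (B.Dtmin - κ₁)) + (4 + κ₁) * (π * Real.sqrt 2)) / (B.Dtmin - κ₁)) + 2 * ((4 + κ₁) * (π * Real.sqrt 2) / (B.Dtmin - κ₁)) + π * Real.sqrt 2))))) + 1) *
              (2 * Cδ * Real.sqrt (2 * (2 * ((((4 + κ₂) * (B.smax + κ₁ * (π * Real.sqrt 2 + 2 * B.smax) / (B.Dtmin - κ₁)) ^ 2 + (8 + 2 * κ₁) * ((4 + κ₁) * (π * Real.sqrt 2) / (B.Dtmin - κ₁)) + (4 + κ₁) * (π * Real.sqrt 2)) / (B.Dtmin - κ₁)) + 2 * ((4 + κ₁) * (π * Real.sqrt 2) / (B.Dtmin - κ₁)) + π * Real.sqrt 2) + κ₁ * ((((4 + κ₂) * (B.smax + κ₁ * (π * Real.sqrt 2 + 2 * B.smax) / (B.Dtmin - κ₁)) ^ 2 + (8 + 2 * κ₁) * ((4 + κ₁) * (π * Real.sqrt 2) / (B.Dtmin - κ₁)) + (4 + κ₁) * (π * Real.sqrt 2)) / (B.Dtmin - κ₁)) + 2 * ((4 + κ₁) * (π * Real.sqrt 2) / (B.Dtmin - κ₁)) + π * Real.sqrt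 2) / 2)) / (B.hmin / 2)) / Real.sqrt Cδ) +
          8 * π * (2 * Cδ * Real.sqrt (2 * (2 * ((((4 + κ₂) * (B.smax + κ₁ * (π * Real.sqrt 2 + 2 * B.smax) / (B.Dtmin - κ₁)) ^ 2 + (8 + 2 * κ₁) * ((4 + κ₁) * (π * Real.sqrt 2) / (B.Dtmin - κ₁)) + (4 + κ₁) * (π * Real.sqrt 2)) / (B.Dtmin - κ₁)) + 2 * ((4 + κ₁) * (π * Real.sqrt 2) / (B.Dtmin - κ₁)) + π * Real.sqrt 2) + κ₁ * ((((4 + κ₂) * (B.smax + κ₁ * (π * Real.sqrt 2 + 2 * B.smax) / (B.Dtmin - κ₁)) ^ 2 + (8 + 2 * κ₁) * ((4 + κ₁) * (π * Real.sqrt 2) / (B.Dtmin - κ₁)) + (4 + κ₁) * (π * Real.sqrt 2)) / (B.Dtmin - κ₁)) + 2 * ((4 + κ₁) * (π * Real.sqrt 2) / (B.Dtmin - κ₁)) + π * Real.sqrt 2) / 2)) / (B.hmin / 2)) / Real.sqrt (2 * Cδ * π)) / w + 4 * N)) := by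
  have hh := B.hmin_pos
  have hℓ₄ : 0 < min (η₀ / (2 * (2 * ((4 + κ₁) * (B.smax + κ₁ * (π * Real.sqrt 2 + 2 * B.smax) / (B.Dtmin - κ₁)))))) (η₁ / (4 * (16 * (B.smax + κ₁ * (π * Real.sqrt 2 + 2 * B.smax) / (B.Dtmin - κ₁)) ^ 2 + 8 * ((((4 + κ₂) * (B.smax + κ₁ * (π * Real.sqrt 2 + 2 * B.smax) / (B.Dtmin - κ₁)) ^ 2 + (8 + 2 * κ₁) * ((4 + κ₁) * (π * Real.sqrt 2) / (B.Dtmin - κ₁)) + (4 + κ₁) * (π * Real.sqrt 2)) / (B.Dtmin - κ₁)) + 2 * ((4 + κ₁) * (π * Real.sqrt 2) / (B.Dtmin - κ₁)) + π * Real.sqrt 2) + 4 * (κ₂ * (B.smax + κ₁ * (π * Real.sqrt 2 + 2 * B.smax) / (B.Dtmin - κ₁)) ^ 2) + 2 * (κ₁ * ((((4 + κ₂) * (B.smax + κ₁ * (π * Real.sqrt 2 + 2 * B.smax) / (B.Dtmin - κ₁)) ^ 2 + (8 + 2 * κ₁) * ((4 + κ₁) * (π * Real.sqrt 2) / (B.Dtmin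 - κ₁)) + (4 + κ₁) * (π * Real.sqrt 2)) / (B.Dtmin - κ₁)) + 2 * ((4 + κ₁) * (π * Real.sqrt 2) / (B.Dtmin - κ₁)) + π * Real.sqrt 2))))) := lt_min (by positivity) (by positivity)
  have hQ₄0 : 0 < (4 * π / min (η₀ / (2 * (2 * ((4 + κ₁) * (B.smax + κ₁ * (π * Real.sqrt 2 + 2 * B.smax) / (B.Dtmin - κ₁)))))) (η₁ / (4 * (16 * (B.smax + κ₁ * (π * Real.sqrt 2 + 2 * B.smax) / (B.Dtmin - κ₁)) ^ 2 + 8 * ((((4 + κ₂) * (B.smax + κ₁ * (π * Real.sqrt 2 + 2 * B.smax) / (B.Dtmin - κ₁)) ^ 2 + (8 + 2 * κ₁) * ((4 + κ₁) * (π * Real.sqrt 2) / (B.Dtmin - κ₁)) + (4 + κ₁) * (π * Real.sqrt 2)) / (B.Dtmin - κ₁)) + 2 * ((4 + κ₁) * (π * Real.sqrt 2) / (B.Dtmin - κ₁)) + π * Real.sqrt 2) + 4 * (κ₂ * (B.smax + κ₁ * (π * Real.sqrt 2 + 2 * B.smax) / (B.Dtmin - κ₁)) ^ 2) + 2 * (κ₁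 * ((((4 + κ₂) * (B.smax + κ₁ * (π * Real.sqrt 2 + 2 * B.smax) / (B.Dtmin - κ₁)) ^ 2 + (8 + 2 * κ₁) * ((4 + κ₁) * (π * Real.sqrt 2) / (B.Dtmin - κ₁)) + (4 + κ₁) * (π * Real.sqrt 2)) / (B.Dtmin - κ₁)) + 2 * ((4 + κ₁) * (π * Real.sqrt 2) / (B.Dtmin - κ₁)) + π * Real.sqrt 2))))) + 1) := by positivity
  -- the per-`σ` count and the level counts, instantiated with the expanded constants
  have hsig := fun σ : ℝ => count_anti_sigmaE B hδs hδ hlo hhi hκ hκ₁ hκ₂ hu (P := P) (σ := σ) hw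
    (by positivity : (0:ℝ) ≤ Cδ * w) hlam hτ hη₀ h2δ hlo' hhi' heven hMa hMG
  have hlev := fun (η : ℝ) (hη : 0 < η) => count_levels_diagE B hδs hδ hlo hhi hκ hκ₁ hκ₂ hu (P := P) hw hN hη hη₀ hη₁ hlo' hhi' hH hM hA
  clear heven hH
  -- make the constants opaque
  generalize hQdef : (4 * π / min (η₀ / (2 * (2 * ((4 + κ₁) * (B.smax + κ₁ * (π * Real.sqrt 2 + 2 * B.smax) / (B.Dtmin - κ₁)))))) (η₁ / (4 * (16 * (B.smax + κ₁ * (π * Real.sqrt 2 + 2 * B.smax) / (B.Dtmin - κ₁)) ^ 2 + 8 * ((((4 + κ₂) * (B.smax + κ₁ * (π * Real.sqrt 2 + 2 * B.smax) / (B.Dtmin - κ₁)) ^ 2 + (8 + 2 * κ₁) * ((4 + κ₁) * (π * Real.sqrt 2) / (B.Dtmin - κ₁)) + (4 + κ₁) * (π * Real.sqrt 2)) / (B.Dtmin - κ₁)) + 2 * ((4 + κ₁) * (π * Real.sqrt 2) / (B.Dtmin - κ₁)) + π * Real.sqrt 2) + 4 * (κ₂ * (B.smax + κ₁ * (π * Real.sqrt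 2 + 2 * B.smax) / (B.Dtmin - κ₁)) ^ 2) + 2 * (κ₁ * ((((4 + κ₂) * (B.smax + κ₁ * (π * Real.sqrt 2 + 2 * B.smax) / (B.Dtmin - κ₁)) ^ 2 + (8 + 2 * κ₁) * ((4 + κ₁) * (π * Real.sqrt 2) / (B.Dtmin - κ₁)) + (4 + κ₁) * (π * Real.sqrt 2)) / (B.Dtmin - κ₁)) + 2 * ((4 + κ₁) * (π * Real.sqrt 2) / (B.Dtmin - κ₁)) + π * Real.sqrt 2))))) + 1) = Q₄ at hlev hQ₄0 ⊢
  generalize hMadef : (2 * ((((4 + κ₂) * (B.smax + κ₁ * (π * Real.sqrt 2 + 2 * B.smax) / (B.Dtmin - κ₁)) ^ 2 + (8 + 2 * κ₁) * ((4 + κ₁) * (π * Real.sqrt 2) / (B.Dtmin - κ₁)) + (4 + κ₁) * (π * Real.sqrt 2)) / (B.Dtmin - κ₁)) + 2 * ((4 + κ₁) * (π * Real.sqrt 2) / (B.Dtmin - κ₁)) + π * Real.sqrt 2) + κ₁ * ((((4 + κ₂) * (B.smax + κ₁ * (π * Real.sqrt 2 + 2 * B.smax) / (B.Dtmin - κ₁))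 ^ 2 + (8 + 2 * κ₁) * ((4 + κ₁) * (π * Real.sqrt 2) / (B.Dtmin - κ₁)) + (4 + κ₁) * (π * Real.sqrt 2)) / (B.Dtmin - κ₁)) + 2 * ((4 + κ₁) * (π * Real.sqrt 2) / (B.Dtmin - κ₁)) + π * Real.sqrt 2) / 2) = Ma at hsig hMa ⊢
  clear hM hA hℓ₄
  generalize hMgdef : (8 * (B.smax + κ₁ * (π * Real.sqrt 2 + 2 * B.smax) / (B.Dtmin - κ₁)) ^ 2 + 2 * (κ₂ * (B.smax + κ₁ * (π * Real.sqrt 2 + 2 * B.smax) / (B.Dtmin - κ₁)) ^ 2) + 4 * ((((4 + κ₂) * (B.smax + κ₁ * (π * Real.sqrt 2 + 2 * B.smax) / (B.Dtmin - κ₁)) ^ 2 + (8 + 2 * κ₁) * ((4 + κ₁) * (π * Real.sqrt 2) / (B.Dtmin - κ₁)) + (4 + κ₁) * (π * Real.sqrt 2)) / (B.Dtmin - κ₁)) + 2 * ((4 + κ₁) * (π * Real.sqrt 2) / (B.Dtmin - κ₁)) + π * Real.sqrt 2) + κ₁ * ((((4 + κ₂) * (B.smax + κ₁ * (π * Real.sqrt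 2 + 2 * B.smax) / (B.Dtmin - κ₁)) ^ 2 + (8 + 2 * κ₁) * ((4 + κ₁) * (π * Real.sqrt 2) / (B.Dtmin - κ₁)) + (4 + κ₁) * (π * Real.sqrt 2)) / (B.Dtmin - κ₁)) + 2 * ((4 + κ₁) * (π * Real.sqrt 2) / (B.Dtmin - κ₁)) + π * Real.sqrt 2)) = Mg at hsig hMG ⊢
  set X := 32 * Q₄ / η₁ + 16 * π / η₀ with hX
  set Y := 8 * Q₄ / Real.sqrt (2 * B.hmin) with hY
  set Z := 2 * Q₄ with hZ
  have hX0 : 0 ≤ X := by positivity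
  have hY0 : 0 ≤ Y := by positivity
  have hZ0 : 0 ≤ Z := by positivity
  set ℓ₅ := min (η₀ / (2 * Ma * τ)) (2 * lam / Mg) with hℓ₅
  have hℓ₅0 : 0 < ℓ₅ := lt_min (by positivity) (by positivity)
  set K₀ := ⌊τ / w⌋₊ with hK₀
  have hK₀τ : (K₀ : ℝ) * w ≤ τ := by
    have := Nat.floor_le (div_nonneg hτ.le hw.le) (a := τ / w)
    rwa [le_div_iff₀ hw] at this
  set bσ : ℕ → ℝ := fun s =>
    if |hfunE δ u μ P (w / 2 + s * (w / 2)) (w / 2 + s * (w / 2))| ≤ 2 * (Cδ * w) then 2 * Real.sqrt (Cδ * w / (B.hmin / 2))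
    else 2 * (Cδ * w) * Real.sqrt (2 * Ma) / (B.hmin / 2 * Real.sqrt |hfunE δ u μ P (w / 2 + s * (w / 2)) (w / 2 + s * (w / 2))|) with hbσ
  have hper : ∀ s ∈ Finset.range (4 * N), ((((Finset.range K₀).filter fun i : ℕ =>
        |hfunE δ u μ P (w / 2 + s * (w / 2) - (w + i * w) / 2) (w / 2 + s * (w / 2) + (w + i * w) / 2)| ≤ Cδ * w ∧
        |h3E δ u P (w / 2 + s * (w / 2) + (w + i * w) / 2) (w / 2 + s * (w / 2) - (w + i * w) / 2) +
          h3E δ u P (w / 2 + s * (w / 2) - (w + i * w) / 2) (w / 2 + s * (w / 2) + (w + i * w) / 2)| ≤ 2 * lam).card : ℝ)) ≤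
      (τ / ℓ₅ + 1) * (2 * (bσ s / w + 1)) := by
    intro s _
    refine (hsig (w / 2 + s * (w / 2))).trans ?_
    have hb0 : 0 ≤ bσ s := by rw [hbσ]; dsimp only; split_ifs <;> positivity
    have hfac : (K₀ : ℝ) * w / ℓ₅ + 1 ≤ τ / ℓ₅ + 1 := by
      have := div_le_div_of_nonneg_right hK₀τ hℓ₅0.le; linarith only [this]
    exact mul_le_mul_of_nonneg_right hfac (by positivity)
  have hT : (((Finset.range (4 * N)).card : ℝ)) ≤ 8 * π / w := by
    rw [Finset.card_range, le_div_iff₀ hw]; push_cast; linarith only [hN]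
  have hdy := dyadic_total (Finset.range (4 * N)) (fun s : ℕ => |hfunE δ u μ P (w / 2 + s * (w / 2)) (w / 2 + s * (w / 2))|)
    hw hw1 hCδ (half_pos hh) hMa hX0 hY0 hZ0 hJ hT hlev
  calc _ ≤ ∑ s ∈ Finset.range (4 * N), (τ / ℓ₅ + 1) * (2 * (bσ s / w + 1)) := Finset.sum_le_sum hper
    _ = (τ / ℓ₅ + 1) * (2 * ((∑ s ∈ Finset.range (4 * N), bσ s) / w + 4 * N)) := by
        rw [← Finset.mul_sum, ← Finset.mul_sum, Finset.sum_add_distrib, Finset.sum_div, Finset.sum_const,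
          Finset.card_range]
        simp
    _ ≤ _ := by
        apply mul_le_mul_of_nonneg_left _ (by positivity)
        apply mul_le_mul_of_nonneg_left _ (by norm_num)
        exact add_le_add (div_le_div_of_nonneg_right hdy hw.le) le_rfl

end DiagCounts

end Summit.HubbardSuperconductivity.HubbardSuperconductivity.Theorems.PerturbedFermiCurve

end
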